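import Mathlib
import HarnessLib
import Summits.ResolutionOfSingularities.ResolutionOfSingularities.Theorems.WildQuotientsWildQuotientResolutionToricExitI2Divisorial
import Summits.ResolutionOfSingularities.ResolutionOfSingularities.Theorems.WildQuotientsWildQuotientResolutionToricExitCentre
import Summits.ResolutionOfSingularities.ResolutionOfSingularities.Theorems.WildQuotientsWildQuotientResolutionBlowupChartStalk
import Literature.AlgebraicGeometry.Resolution.BlowupPrincipalCharts

/-!
# V3U-F brick `Hdivb`: the divisorial clause at the points of the principal chart `V[x_b²]`
(crux stmt-ResolutionOfSingularities-15640 `WildQuotients.WildQuotientResolution`, line `Sketch`;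
chain w45c programme V3U, `L/w45c/CHAIN.md` v6 §4 lead-1 row — the brick `Hdivb` of
res-L1-w45c-lead-1's `ToricExit.jordanThree_hasResolution_of_bricks` (p496627), discharged by
res-D-pv-033 AS res-L1-w45c-stub-5; [OURS · L1 W4.5c] — NOT a statement of any manuscript.)

For the `J₃` datum (`σ x_a = x_a`, `σ x_b = x_b + x_a`, `σ x_c = x_c + x_b`, passengers fixed) over
a field of characteristic `p ≥ 3`, `V = Bl_{(x_a, x_b²)} 𝔸ⁿ` (`affineBlowup`) with the lifted action
`(affineBlowup.isBlowup _).liftAction ρ (ToricExit.idealSheaf_centre_comap …)`: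

* `ToricExit.isPrincipal_stalkAug_liftAction_of_mem_blowupChart` — at every point `v` of the
  principal chart `V[⊤, x_b²] = blowupChart π Ĩ₂ ⊤ x_b²` fixed by the lift of `g ∈ ⟨σ⟩`, the stalk
  augmentation ideal `⟨(stalkSpecializes ≫ g^♯_v) s − s⟩` is principal.

This is VERBATIM the hypothesis `Hdivb` of p496627. Proof = lead-1's generic divisorial clause
`ToricExit.I2.isPrincipal_stalkAug_liftAction_of_mem` (p486940) + stub-3's chart dictionary
`BlowupExit.map_germ_mem_span_of_mem_blowupChart_spec` (p489049: on `V[⊤, g]` every `f ∈ I` is a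
multiple of `g` in the stalk), which supplies its hypothesis `x_a ∈ (x_b)² · 𝒪_{V,v}`.
-/

-- single-problem summit: the doubled namespace component `ResolutionOfSingularities` is forced
set_option linter.dupNamespace false

noncomputable section

open CategoryTheory AlgebraicGeometry TopologicalSpace MvPolynomial
open Literature.AlgebraicGeometry.Resolution

namespace Summit.ResolutionOfSingularities.ResolutionOfSingularities.Theorems.WildQuotientResolution.ToricExit

/-- **Brick `Hdivb` of the J₃ toric exit** (hypothesis `Hdivb` of
`ToricExit.jordanThree_hasResolution_of_bricks`, p496627, literally): for `V = Bl_{(x_a,x_b²)} 𝔸ⁿ`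
with the lifted action of `⟨σ⟩`, at every point `v` of the principal chart `V[⊤, x_b²]` fixed by
the lift of `g`, the stalk augmentation ideal of `g` is principal. [OURS · L1 W4.5c]
[folklore; assembly of landed decls] -/
theorem isPrincipal_stalkAug_liftAction_of_mem_blowupChart (p : ℕ) (hp : p.Prime) (hp3 : 3 ≤ p)
    (k : Type) [Field k] [CharP k p] (n : ℕ)
    (σ : MvPolynomial (Fin n) k ≃ₐ[k] MvPolynomial (Fin n) k)
    (a b c : Fin n) (hab : a ≠ b) (hac : a ≠ c)
    (hb : σ (X b) = X b + X a) (hc : σ (X c) = X c + X b)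
    (hσ : ∀ i, i ≠ b → i ≠ c → σ (X i) = X i)
    (ρ : ↥(Subgroup.zpowers σ) →* Aut (Spec (CommRingCat.of (MvPolynomial (Fin n) k))))
    (hρ : ∀ g : ↥(Subgroup.zpowers σ), (ρ g).hom = Spec.map (CommRingCat.ofHom
      ((MulSemiringAction.toRingEquiv (↥(Subgroup.zpowers σ)) (MvPolynomial (Fin n) k) g⁻¹ :
        MvPolynomial (Fin n) k ≃+* MvPolynomial (Fin n) k) :
          MvPolynomial (Fin n) k →+* MvPolynomial (Fin n) k)))
    (g : ↥(Subgroup.zpowers σ))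
    (v : affineBlowup (Ideal.span (Set.range (![X a, X b ^ 2] :
      Fin 2 → MvPolynomial (Fin n) k))))
    (hv : (((affineBlowup.isBlowup (Ideal.span (Set.range (![X a, X b ^ 2] :
        Fin 2 → MvPolynomial (Fin n) k)))).liftAction ρ
        (idealSheaf_centre_comap k n σ a b c hab hac hb hσ ρ hρ)) g).hom.base v = v)
    (hvB : v ∈ blowupChart
      (affineBlowup.π (Ideal.span (Set.range (![X a, X b ^ 2] : Fin 2 → MvPolynomial (Fin n) k))))
      (affineBlowup.idealSheaf (Ideal.span (Set.range (![X a, X b ^ 2] :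
        Fin 2 → MvPolynomial (Fin n) k))))
      ⟨⊤, isAffineOpen_top _⟩
      ((Scheme.ΓSpecIso (CommRingCat.of (MvPolynomial (Fin n) k))).inv.hom (X b ^ 2))) :
    (Ideal.span (Set.range fun s =>
      ((affineBlowup (Ideal.span (Set.range (![X a, X b ^ 2] :
        Fin 2 → MvPolynomial (Fin n) k)))).presheaf.stalkSpecializes (specializes_of_eq hv) ≫
        (((affineBlowup.isBlowup (Ideal.span (Set.range (![X a, X b ^ 2] :
          Fin 2 → MvPolynomial (Fin n) k)))).liftAction ρ
          (idealSheaf_centre_comap k n σ a b c hab hac hb hσ ρ hρ)) g).hom.stalkMap v).hom s -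
          s)).IsPrincipal := by
  -- the chart dictionary: on `V[⊤, x_b²]`, `x_a ∈ (x_b²) · 𝒪_{V,v}`
  have hXa : (X a : MvPolynomial (Fin n) k) ∈
      Ideal.span (Set.range (![X a, X b ^ 2] : Fin 2 → MvPolynomial (Fin n) k)) :=
    Ideal.subset_span ⟨0, rfl⟩
  have hmem := BlowupExit.map_germ_mem_span_of_mem_blowupChart_spec
    (affineBlowup.π (Ideal.span (Set.range (![X a, X b ^ 2] : Fin 2 → MvPolynomial (Fin n) k))))
    (Ideal.span (Set.range (![X a, X b ^ 2] : Fin 2 → MvPolynomial (Fin n) k))) hXa hvB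
  rw [map_pow, map_pow] at hmem
  exact I2.isPrincipal_stalkAug_liftAction_of_mem p hp hp3 k n σ a b c hab hac hb hc hσ
    (![X a, X b ^ 2]) rfl rfl ρ hρ (affineBlowup.isBlowup _)
    (idealSheaf_centre_comap k n σ a b c hab hac hb hσ ρ hρ) g v hv hmem

end Summit.ResolutionOfSingularities.ResolutionOfSingularities.Theorems.WildQuotientResolution.ToricExit

end
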